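import Literature.NumberTheory.LFunctions.GaussianHeckeRichertBound
import Literature.NumberTheory.LFunctions.GaussianHeckeThreeFourOne
import Literature.NumberTheory.LFunctions.GaussianHeckeVKRegion
import HarnessLib

/-!
# Coleman's zero-free region for the Hecke `L`-functions `L(s, λ^m)` of `ℚ(i)` from a Richert-type bound
# (the Landau–Titchmarsh deduction), and from the lattice exponential-sum hypothesis

Topic `Literature/NumberTheory/LFunctions`.  Everything in this file is PROVED; no definitions, no named facts.
For the continued Dirichlet series `D_m = 4L(·, λ^m)` of the angular characters `λ^m(z) = (z/|z|)^{4m}` of `ℤ[i]`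
(`GaussianHecke.heckeL`, `m ≥ 1`) we prove the `ℚ(i)`-analogue of Titchmarsh's Theorem 3.10 / §6.19 (for Dirichlet
`L`-functions: `VinogradovKorobovFromRichert.lean`, whose constants and lemmas are reused verbatim):

* `exists_hasVKZeroFreeRegion_of_richert` — **Richert-type bound ⟹ Coleman's region**: if for all `m ≥ 1`,
  `1/2 ≤ σ ≤ 2` and real `t`, `‖D_m(σ + it)‖ ≤ A log V · V^{B max(1−σ,0)^{3/2}}` (`V = m + |t| + 3`), then
  `∃ c > 0, GaussianHecke.HasVKZeroFreeRegion c 21`: for `m ≥ 1`, `V ≥ 21`,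
  `D_m(s) ≠ 0` whenever `Re s ≥ 1 − c/((log V)^{2/3}(log log V)^{1/3})` — the shape of M. D. Coleman,
  *A zero-free region for the Hecke L-functions*, Mathematika 37 (1990), Theorem 2, for `K = ℚ(i)`, `𝔣 = 1`, `𝐦 ≠ 0`;
* `exists_hasVKZeroFreeRegion_of_latticeExpSumBound` — the same from the Vinogradov-type hypothesis
  `GaussianHecke.LatticeExpSumBound C D` on the lattice sums `∑_{M < N z ≤ u} λ^m(z) N(z)^{-it}`
  (through `GaussianHecke.exists_richert_of_latticeExpSumBound`).

## The argument (Landau 1924 / Titchmarsh §3.9–3.10, uniformly in `m`)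

Let `ρ = β + iγ` be a zero of `D_m`, `m ≥ 1`, `V = m + |γ| + 3 ≥ 21`, `ℓ = log V ≥ 3`, `Y = ℓ^{2/3}(log ℓ)^{1/3}`
(`VKFromRichert.Yv`), `R = log ℓ/(16Y)` (`Rr ℓ 0`), `d = W⁻²/(16Y)` (`dd`), and apply Titchmarsh's Lemma α
(`VKFromRichert.neg_re_logDeriv_le`) to `D_m` on the disc of radius `2R` about `1 + d + iγ` and to `D_{2m}` about
`1 + d + 2iγ`: there `|D| ≤ 2Aℓ^{3+B/10}` (the Richert-type bound with `V'^{B(1−σ')^{3/2}} ≤ ℓ^{B/10}`,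
`log V' ≤ 2ℓ`), while `‖D_k(1 + d + it)‖ ≥ κ d` (`GaussianHecke.exists_norm_heckeL_ge`); hence with
`E = 8(log(2M/d) + 1)/R`, `M = 2(A/κ)ℓ^{3+B/10} + 42ℓ`: `Re P_m(1+d+iγ) ≤ E − 1/(1 + d − β)`, `Re P_{2m}(1+d+2iγ) ≤ E`,
and `Re P_0(1+d) ≤ 1/d + K₀`.  The `3-4-1` inequality for `P = −D'/D` (`GaussianHecke.re_heckeP_comb_nonneg`; no third
function with a pole occurs since `2m ≠ 0`) gives `4/(d + η) ≤ 3/d + 3K₀ + 5E` (`η = 1 − β`), impossible for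
`η < d/8` as `3K₀ + 5E < 5/(9d)` (`VKFromRichert.const_facts`).  So `1 − β ≥ d/8 = 1/(128 W² Y)`, `c = 1/(256 W²)`.

## References

* M. D. Coleman, *A zero-free region for the Hecke L-functions*, Mathematika 37 (1990), 287–304, Theorem 2.
  [cite: ColemanMathematika1990, Theorem 2]
* E. C. Titchmarsh, *The Theory of the Riemann Zeta-Function*, 2nd ed. (1986), §3.9 Lemma α, Theorem 3.10, §6.19.
  [cite: Titchmarsh1986, Theorem 3.10]
* G. Harman, *Prime-Detecting Sieves*, Princeton UP 2007, §11.4 (Lemma 11.6 and ref. [23]: the consumer).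
  [cite: Harman2007, Lemma 11.6]
-/

noncomputable section

open Complex Filter Topology Metric Set

namespace Literature.NumberTheory.LFunctions

namespace GaussianHecke

open VKFromRichert RichertFromExpSum

/-! ### Geometry of the discs -/

/-- For `z` in the disc `|z − (1 + d + it)| ≤ 2R` with `0 < d ≤ R`: `1 − 2R ≤ Re z ≤ 1 + 3R` and
`|Im z − t| ≤ 2R`. [folklore] -/
theorem disc_geom' {d R t : ℝ} {z : ℂ} (hd : 0 < d) (hdR : d ≤ R)
    (hz : z ∈ closedBall (((1 + d : ℝ) : ℂ) + t * I) (2 * R)) :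
    1 - 2 * R ≤ z.re ∧ z.re ≤ 1 + 3 * R ∧ |z.im - t| ≤ 2 * R := by
  rw [mem_closedBall, dist_eq_norm] at hz
  have hre := (Complex.abs_re_le_norm (z - (((1 + d : ℝ) : ℂ) + t * I))).trans hz
  have him := (Complex.abs_im_le_norm (z - (((1 + d : ℝ) : ℂ) + t * I))).trans hz
  have e1 : (z - (((1 + d : ℝ) : ℂ) + t * I)).re = z.re - (1 + d) := by simp
  have e2 : (z - (((1 + d : ℝ) : ℂ) + t * I)).im = z.im - t := by simp
  rw [e1, abs_le] at hre
  rw [e2] at him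
  exact ⟨by linarith, by linarith, him⟩

/-- `log(x + 1/8) ≤ log x + 1` for `x ≥ 3`, and `log(2x) ≤ log x + 1` for `x > 0`. [folklore] -/
theorem log_add_le {x : ℝ} (hx : 3 ≤ x) : Real.log (x + 1 / 8) ≤ Real.log x + 1 := by
  have hx0 : 0 < x := by linarith
  have h2 : Real.log 2 ≤ 1 := by have := Real.log_two_lt_d9; linarith
  calc Real.log (x + 1 / 8) ≤ Real.log (2 * x) := Real.log_le_log (by linarith) (by linarith)
    _ = Real.log 2 + Real.log x := Real.log_mul (by norm_num) hx0.ne'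
    _ ≤ Real.log x + 1 := by linarith

/-! ### The disc bound from the Richert-type bound -/

/-- **The disc bound for `D_k`.**  Assume the Richert-type bound with constants `(A, B)` (`A ≥ 1`, `B ≥ 0`).  Let
`k ≥ 1`, `ℓ ≥ 3` with `log(k + |t| + 3) ≤ ℓ + 1`, `R = R(ℓ, 0)`, `0 < d ≤ R`.  Then on `|z − (1 + d + it)| ≤ 2R`:
`‖D_k(z)‖ ≤ 2A ℓ^{3 + B/10}` (for `Re z ≤ 1` by the Richert-type bound with `V'^{B(1−σ')^{3/2}} ≤ ℓ^{B/10}`,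
`log V' ≤ 2ℓ`; for `Re z ≥ 1` by the same bound with exponent `0`). [folklore] -/
theorem norm_heckeL_le_on_disc {A B : ℝ} (hA : 1 ≤ A) (hB : 0 ≤ B)
    (hRich : ∀ (m : ℕ), 1 ≤ m → ∀ (σ t : ℝ), 1 / 2 ≤ σ → σ ≤ 2 →
      ‖heckeL m (σ + t * I)‖ ≤ A * Real.log ((m : ℝ) + |t| + 3) *
        ((m : ℝ) + |t| + 3) ^ (B * (max (1 - σ) 0) ^ (3 / 2 : ℝ)))
    {k : ℕ} (hk : 1 ≤ k) {ℓ : ℝ} (hℓ : 3 ≤ ℓ) {t d : ℝ} (htℓ : Real.log ((k : ℝ) + |t| + 3) ≤ ℓ + 1)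
    (hd : 0 < d) (hdR : d ≤ Rr ℓ 0) :
    ∀ z ∈ closedBall (((1 + d : ℝ) : ℂ) + t * I) (2 * Rr ℓ 0), ‖heckeL k z‖ ≤ 2 * A * ℓ ^ (3 + B / 10) := by
  intro z hz
  obtain ⟨hR0, hR16, -, hRexp⟩ := Rr_facts hℓ le_rfl (by linarith : (0 : ℝ) ≤ ℓ)
  set R := Rr ℓ 0 with hRdef
  obtain ⟨hzre1, hzre2, hzim⟩ := disc_geom' hd hdR hz
  have hℓ1 : 1 ≤ ℓ := by linarith
  have hℓ0 : 0 < ℓ := by linarith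
  have hk1 : (1 : ℝ) ≤ k := by exact_mod_cast hk
  -- the scale at `z`
  set V' : ℝ := (k : ℝ) + |z.im| + 3 with hV'
  have hV'3 : 3 ≤ V' := by rw [hV']; linarith [abs_nonneg z.im]
  have hV'0 : 0 < V' := by linarith
  have hlogV' : Real.log V' ≤ 2 * ℓ := by
    have him : |z.im| ≤ |t| + 1 / 8 := by
      have := abs_sub_abs_le_abs_sub z.im t
      linarith [abs_le.mp (show |z.im - t| ≤ 1 / 8 from hzim.trans (by linarith))]
    have hV'le : V' ≤ ((k : ℝ) + |t| + 3) + 1 / 8 := by rw [hV']; linarith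
    have h3 : (3 : ℝ) ≤ (k : ℝ) + |t| + 3 := by linarith [abs_nonneg t]
    calc Real.log V' ≤ Real.log (((k : ℝ) + |t| + 3) + 1 / 8) := Real.log_le_log hV'0 hV'le
      _ ≤ Real.log ((k : ℝ) + |t| + 3) + 1 := log_add_le h3
      _ ≤ 2 * ℓ := by linarith
  have hlogV'0 : 0 ≤ Real.log V' := Real.log_nonneg (by linarith)
  have hzs : heckeL k z = heckeL k ((z.re : ℂ) + z.im * I) := by rw [Complex.re_add_im]
  -- `ℓ ≤ ℓ^{3+B/10}` etc.
  have hℓpow : ℓ * ℓ ^ (B / 10) ≤ ℓ ^ (3 + B / 10) := by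
    calc ℓ * ℓ ^ (B / 10) = ℓ ^ (1 + B / 10) := by
          rw [Real.rpow_add hℓ0, Real.rpow_one]
      _ ≤ ℓ ^ (3 + B / 10) := Real.rpow_le_rpow_of_exponent_le hℓ1 (by linarith)
  have hℓp : ℓ ≤ ℓ ^ (3 + B / 10) := by
    calc ℓ = ℓ ^ (1 : ℝ) := (Real.rpow_one ℓ).symm
      _ ≤ ℓ ^ (3 + B / 10) := Real.rpow_le_rpow_of_exponent_le hℓ1 (by linarith)
  have hA0 : 0 ≤ A := by linarith
  rcases le_or_gt z.re 1 with hzre | hzre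
  · -- `Re z ≤ 1`: Richert-type bound with `max(1 - σ, 0) = 1 - σ`
    have h := hRich k hk z.re z.im (by linarith) (by linarith)
    rw [← hzs] at h
    have hmax : max (1 - z.re) 0 = 1 - z.re := max_eq_left (by linarith)
    rw [hmax] at h
    obtain ⟨hfac, -⟩ := richert_factors_le (B := B) (P := 0) (σ' := z.re) (t' := V') hB le_rfl hℓ
      (by linarith) (by linarith) (by rw [abs_of_pos hV'0]; exact hV'3) (by rw [abs_of_pos hV'0]; exact hlogV')
      hRexp
    rw [abs_of_pos hV'0] at hfac
    calc ‖heckeL k z‖ ≤ A * Real.log V' * V' ^ (B * (1 - z.re) ^ (3 / 2 : ℝ)) := h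
      _ ≤ A * (2 * ℓ) * ℓ ^ (B / 10) := by gcongr
      _ = 2 * A * (ℓ * ℓ ^ (B / 10)) := by ring
      _ ≤ 2 * A * ℓ ^ (3 + B / 10) := by gcongr
  · -- `Re z ≥ 1`: exponent `0`
    have h := hRich k hk z.re z.im (by linarith) (by linarith)
    rw [← hzs] at h
    have hmax : max (1 - z.re) 0 = 0 := max_eq_right (by linarith)
    rw [hmax, Real.zero_rpow (by norm_num), mul_zero, Real.rpow_zero, mul_one] at h
    calc ‖heckeL k z‖ ≤ A * Real.log V' := h
      _ ≤ A * (2 * ℓ) := by gcongr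
      _ = 2 * A * ℓ := by ring
      _ ≤ 2 * A * ℓ ^ (3 + B / 10) := by gcongr

/-! ### A zero too close to `σ = 1` -/

set_option maxHeartbeats 800000 in
/-- **A zero `β + iγ` of `D_m` (`m ≥ 1`) with `V = m + |γ| + 3 ≥ 21` has `1 − β ≥ d/8 = 1/(128 W² Y(log V))`.**
Landau's argument as in `VKFromRichert.one_sub_re_ge_L`, with the three functions `D_0(1+d)`, `D_m(1+d+iγ)`,
`D_{2m}(1+d+2iγ)` (`2m ≥ 2`, so the third function never has a pole), constants `A' = A/κ`, `P = 0`.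
[cite: Titchmarsh1986, Theorem 3.10 (proof)] [cite: ColemanMathematika1990, Theorem 2] -/
theorem one_sub_re_ge {A B K₀ κ : ℝ} (hA : 1 ≤ A) (hB : 0 ≤ B) (hK₀ : 0 ≤ K₀) (hκ : 0 < κ) (hκ1 : κ ≤ 1)
    (hRich : ∀ (m : ℕ), 1 ≤ m → ∀ (σ t : ℝ), 1 / 2 ≤ σ → σ ≤ 2 →
      ‖heckeL m (σ + t * I)‖ ≤ A * Real.log ((m : ℝ) + |t| + 3) *
        ((m : ℝ) + |t| + 3) ^ (B * (max (1 - σ) 0) ^ (3 / 2 : ℝ)))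
    (hP0 : ∀ d : ℝ, 0 < d → d ≤ 1 → (heckeP 0 ((1 + d : ℝ) : ℂ)).re ≤ 1 / d + K₀)
    (hlow : ∀ (k : ℕ) (d : ℝ), 0 < d → d ≤ 1 → ∀ t : ℝ, κ * d ≤ ‖heckeL k (1 + d + t * I)‖)
    {m : ℕ} (hm : 1 ≤ m) {ρ : ℂ} (hρ : heckeL m ρ = 0) (hV : 21 ≤ (m : ℝ) + |ρ.im| + 3) :
    dd (A / κ) B 0 K₀ (Real.log ((m : ℝ) + |ρ.im| + 3)) 0 / 8 ≤ 1 - ρ.re := by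
  have hm0 : m ≠ 0 := by omega
  have h2m0 : 2 * m ≠ 0 := by omega
  set γ : ℝ := ρ.im with hγdef
  set V : ℝ := (m : ℝ) + |γ| + 3 with hVdef
  set ℓ : ℝ := Real.log V with hℓdef
  have hℓ : 3 ≤ ℓ := three_le_log_of_ge hV
  have hA' : 1 ≤ A / κ := by
    rw [le_div_iff₀ hκ]; nlinarith
  obtain ⟨hW, hd0, h2dR, hd1, hM0, hdec⟩ := const_facts (P := 0) hA' hB le_rfl hK₀ hℓ le_rfl (by linarith : (0 : ℝ) ≤ ℓ)
  obtain ⟨hR0, hR16, -, -⟩ := Rr_facts hℓ le_rfl (by linarith : (0 : ℝ) ≤ ℓ)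
  set d := dd (A / κ) B 0 K₀ ℓ 0 with hddef
  set R := Rr ℓ 0 with hRdef
  set M := Mm (A / κ) B 0 ℓ with hMdef
  set E := EE (A / κ) B 0 K₀ ℓ 0 with hEdef
  have hE_eq : E = 8 * (Real.log (2 * M / d) + 1) / R := by rw [hEdef, EE]
  have hdR : d ≤ R := by linarith
  -- `β < 1`, `η = 1 − β > 0`
  have hβ1 : ρ.re < 1 := by
    by_contra hcon
    exact heckeL_ne_zero_of_one_le_re hm0 (not_lt.1 hcon) hρ
  by_contra hlt
  rw [not_le] at hlt
  set η : ℝ := 1 - ρ.re with hηdef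
  have hη0 : 0 < η := by rw [hηdef]; linarith
  -- heights: `log(m + |γ| + 3) ≤ ℓ + 1` trivially, `log(2m + |2γ| + 3) ≤ ℓ + 1`
  have hV0 : 0 < V := by linarith
  have hγℓ : Real.log ((m : ℝ) + |γ| + 3) ≤ ℓ + 1 := by rw [hℓdef, hVdef]; linarith
  have h2γℓ : Real.log (((2 * m : ℕ) : ℝ) + |2 * γ| + 3) ≤ ℓ + 1 := by
    have hle : ((2 * m : ℕ) : ℝ) + |2 * γ| + 3 ≤ 2 * V := by
      rw [hVdef, abs_mul, abs_two]; push_cast; linarith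
    have hlog2 : Real.log 2 ≤ 1 := by have := Real.log_two_lt_d9; linarith
    have hpos : 0 < ((2 * m : ℕ) : ℝ) + |2 * γ| + 3 := by positivity
    calc Real.log (((2 * m : ℕ) : ℝ) + |2 * γ| + 3) ≤ Real.log (2 * V) := Real.log_le_log hpos hle
      _ = Real.log 2 + Real.log V := Real.log_mul (by norm_num) hV0.ne'
      _ ≤ ℓ + 1 := by rw [hℓdef]; linarith
  -- the points
  have hσ : 1 < 1 + d := by linarith
  set c₁ : ℂ := ((1 + d : ℝ) : ℂ) + (γ : ℂ) * I with hc₁def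
  set c₂ : ℂ := ((1 + d : ℝ) : ℂ) + ((2 * γ : ℝ) : ℂ) * I with hc₂def
  have hc₁re : c₁.re = 1 + d := by simp [hc₁def]
  have hc₁im : c₁.im = γ := by simp [hc₁def]
  have hc₂re : c₂.re = 1 + d := by simp [hc₂def]
  have hc₁1 : 1 < c₁.re := by rw [hc₁re]; exact hσ
  have hc₂1 : 1 < c₂.re := by rw [hc₂re]; exact hσ
  have e₁ : (1 : ℂ) + (d : ℂ) + (γ : ℂ) * I = c₁ := by rw [hc₁def]; push_cast; ring
  have e₂ : ((1 + d : ℝ) : ℂ) + 2 * (γ : ℂ) * I = c₂ := by rw [hc₂def]; push_cast; ring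
  have e₂' : (1 : ℂ) + (d : ℂ) + ((2 * γ : ℝ) : ℂ) * I = c₂ := by rw [hc₂def]; push_cast; ring
  -- the disc bounds `‖D‖ ≤ 2Aℓ^{3+B/10} ≤ 2κ M`
  have hM2 : 2 * A * ℓ ^ (3 + B / 10) ≤ 2 * κ * M := by
    rw [hMdef, Mm]
    have h1 : (2 : ℝ) ^ ((0 : ℝ) + 1) = 2 := by norm_num
    rw [h1]
    have hℓ0 : 0 < ℓ := by linarith
    have hℓp : 0 ≤ ℓ ^ ((0 : ℝ) + 3 + B / 10) := Real.rpow_nonneg hℓ0.le _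
    have e : 2 * κ * (2 * (A / κ) * ℓ ^ ((0 : ℝ) + 3 + B / 10) + 42 * ℓ) =
        4 * A * ℓ ^ ((0 : ℝ) + 3 + B / 10) + 84 * κ * ℓ := by field_simp; ring
    rw [e, show (3 : ℝ) + B / 10 = 0 + 3 + B / 10 by ring]
    have hA0 : 0 ≤ A := by linarith
    nlinarith [mul_nonneg hA0 hℓp, mul_nonneg hκ.le hℓ0.le]
  -- X₀
  have hX₀ : (heckeP 0 ((1 + d : ℝ) : ℂ)).re ≤ 1 / d + K₀ := hP0 d hd0 hd1
  -- the Lemma α package at a centre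
  have hα_pkg : ∀ {k : ℕ}, 1 ≤ k → ∀ {c : ℂ} {t : ℝ}, c = ((1 + d : ℝ) : ℂ) + (t : ℂ) * I →
      Real.log ((k : ℝ) + |t| + 3) ≤ ℓ + 1 →
      (-(deriv (heckeL k) c / heckeL k c)).re ≤ E ∧
      ∀ ρ' : ℂ, heckeL k ρ' = 0 → ‖ρ' - c‖ ≤ R → ρ'.im = c.im →
        (-(deriv (heckeL k) c / heckeL k c)).re ≤ E - 1 / (c.re - ρ'.re) := by
    intro k hk c t hc htℓ
    have hk0 : k ≠ 0 := by omega
    have hMdisc := norm_heckeL_le_on_disc hA hB hRich hk hℓ htℓ hd0 hdR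
    have hdiff : DifferentiableOn ℂ (heckeL k) (ball c (1 / 4)) := (differentiable_heckeL hk0).differentiableOn
    have hzeros : ∀ a, heckeL k a = 0 → ‖a - c‖ ≤ R → a.re < c.re := by
      intro a ha _
      have hcre : c.re = 1 + d := by rw [hc]; simp
      rw [hcre]
      have : a.re < 1 := by
        by_contra hcon
        exact heckeL_ne_zero_of_one_le_re hk0 (not_lt.1 hcon) ha
      linarith
    have hfc : 2 * κ * d / 2 ≤ ‖heckeL k c‖ := by
      have := hlow k d hd0 hd1 t
      rw [hc]
      have e : (1 : ℂ) + (d : ℂ) + (t : ℂ) * I = ((1 + d : ℝ) : ℂ) + (t : ℂ) * I := by push_cast; ring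
      rw [← e]
      linarith
    have hMdisc' : ∀ z ∈ closedBall c (2 * R), ‖heckeL k z‖ ≤ 2 * κ * M := by
      intro z hz
      rw [hc] at hz
      exact (hMdisc z hz).trans hM2
    obtain ⟨h1, h2⟩ := neg_re_logDeriv_le (M := 2 * κ * M) (d := 2 * κ * d) hdiff hR0 hR16 hMdisc'
      (by positivity) hfc hzeros
    have hEq : 8 * (Real.log (2 * (2 * κ * M) / (2 * κ * d)) + 1) / R = E := by
      rw [hE_eq]
      congr 3
      field_simp
    rw [hEq] at h1 h2
    exact ⟨h1, h2⟩
  -- X₁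
  have hX₁ : (heckeP m c₁).re ≤ E - 1 / (d + η) := by
    obtain ⟨-, h2⟩ := hα_pkg hm (c := c₁) (t := γ) hc₁def hγℓ
    have hρc : ‖ρ - c₁‖ ≤ R := by
      have e : ρ - c₁ = ((ρ.re - (1 + d) : ℝ) : ℂ) := Complex.ext (by simp [hc₁def]) (by simp [hc₁def, hγdef])
      rw [e, Complex.norm_real, Real.norm_eq_abs, abs_le]
      constructor <;> linarith
    have h := h2 ρ hρ hρc (by rw [hc₁im])
    rw [hc₁re] at h
    rw [heckeP_eq_neg_deriv_div m hc₁1, neg_div]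
    have e3 : 1 + d - ρ.re = d + η := by rw [hηdef]; ring
    rw [e3] at h
    exact h
  -- X₂
  have hX₂ : (heckeP (2 * m) c₂).re ≤ E := by
    obtain ⟨h1, -⟩ := hα_pkg (k := 2 * m) (by omega) (c := c₂) (t := 2 * γ) hc₂def h2γℓ
    rw [heckeP_eq_neg_deriv_div (2 * m) hc₂1, neg_div]
    exact h1
  -- 3-4-1 and the contradiction
  have h341 := re_heckeP_comb_nonneg m hσ γ
  rw [e₂] at h341
  have h341' : 0 ≤ 3 * (heckeP 0 ((1 + d : ℝ) : ℂ)).re + 4 * (heckeP m c₁).re + (heckeP (2 * m) c₂).re := by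
    have : (3 * heckeP 0 ((1 + d : ℝ) : ℂ) + 4 * heckeP m c₁ + heckeP (2 * m) c₂).re =
        3 * (heckeP 0 ((1 + d : ℝ) : ℂ)).re + 4 * (heckeP m c₁).re + (heckeP (2 * m) c₂).re := by
      simp [Complex.add_re, Complex.mul_re]
    rw [← this]
    convert h341 using 2
  have h1 := three_four_one_algebra h341' hX₀ hX₁ hX₂
  have h2 := core_ineq hd0 hη0 h1 hlt
  linarith

/-! ### The zero-free region -/

/-- **Coleman's zero-free region for `L(s, λ^m)`, `m ≥ 1`, from the Richert-type bound**:
`∃ c > 0, GaussianHecke.HasVKZeroFreeRegion c 21`, i.e. for `V = m + |Im s| + 3 ≥ 21`,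
`D_m(s) ≠ 0` whenever `Re s ≥ 1 − c/((log V)^{2/3}(log log V)^{1/3})`.
[cite: ColemanMathematika1990, Theorem 2] [cite: Titchmarsh1986, Theorem 3.10 and §6.19] -/
theorem exists_hasVKZeroFreeRegion_of_richert {A B : ℝ} (hA : 1 ≤ A) (hB : 0 ≤ B)
    (hRich : ∀ (m : ℕ), 1 ≤ m → ∀ (σ t : ℝ), 1 / 2 ≤ σ → σ ≤ 2 →
      ‖heckeL m (σ + t * I)‖ ≤ A * Real.log ((m : ℝ) + |t| + 3) *
        ((m : ℝ) + |t| + 3) ^ (B * (max (1 - σ) 0) ^ (3 / 2 : ℝ))) :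
    ∃ c : ℝ, 0 < c ∧ HasVKZeroFreeRegion c 21 := by
  obtain ⟨K₀, hK₀, hP0⟩ := exists_re_heckeP_zero_le
  obtain ⟨κ, hκ, hlow⟩ := exists_norm_heckeL_ge
  -- normalise `κ ≤ 1`
  set κ' : ℝ := min κ 1 with hκ'
  have hκ'0 : 0 < κ' := lt_min hκ one_pos
  have hκ'1 : κ' ≤ 1 := min_le_right _ _
  have hlow' : ∀ (k : ℕ) (d : ℝ), 0 < d → d ≤ 1 → ∀ t : ℝ, κ' * d ≤ ‖heckeL k (1 + d + t * I)‖ :=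
    fun k d hd hd1 t ↦ le_trans (mul_le_mul_of_nonneg_right (min_le_left _ _) hd.le) (hlow k d hd hd1 t)
  set W := Wc (A / κ') B 0 K₀ with hWdef
  have hA' : 1 ≤ A / κ' := by rw [le_div_iff₀ hκ'0]; nlinarith
  have hW : 6400 ≤ W := by
    have := (const_facts (P := 0) (ℓ := 3) (Lq := 0) hA' hB le_rfl hK₀ le_rfl le_rfl (by norm_num)).1
    rw [hWdef]; exact this
  have hW0 : 0 < W := by linarith
  refine ⟨1 / (256 * W ^ 2), by positivity, fun m s hm hVs hre hzero ↦ ?_⟩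
  set c : ℝ := 1 / (256 * W ^ 2) with hcdef
  set V : ℝ := (m : ℝ) + |s.im| + 3 with hVdef
  set ℓ : ℝ := Real.log V with hℓdef
  have hℓ : 3 ≤ ℓ := three_le_log_of_ge hVs
  obtain ⟨hY0, -, -, -⟩ := Yv_facts hℓ
  change 1 - c / Yv ℓ ≤ s.re at hre
  have h := one_sub_re_ge hA hB hK₀ hκ'0 hκ'1 hRich hP0 hlow' hm hzero hVs
  have hd : dd (A / κ') B 0 K₀ ℓ 0 / 8 = 1 / (128 * W ^ 2) / Yv ℓ := by
    rw [dd, calL, ← hWdef]; field_simp; ring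
  rw [hd] at h
  have hkey : c / Yv ℓ < 1 / (128 * W ^ 2) / Yv ℓ := by
    rw [div_lt_div_iff_of_pos_right hY0, hcdef, div_lt_div_iff₀ (by positivity) (by positivity)]
    nlinarith
  linarith

/-- **Coleman's zero-free region for `L(s, λ^m)` over `ℚ(i)` from the lattice exponential-sum hypothesis**:
`LatticeExpSumBound C D → ∃ c > 0, HasVKZeroFreeRegion c 21`. [cite: ColemanMathematika1990, Theorem 2] -/
theorem exists_hasVKZeroFreeRegion_of_latticeExpSumBound {C D : ℝ} (h : LatticeExpSumBound C D) (hC : 0 ≤ C)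
    (hD : 0 < D) : ∃ c : ℝ, 0 < c ∧ HasVKZeroFreeRegion c 21 := by
  obtain ⟨A, hA, hRich⟩ := exists_richert_of_latticeExpSumBound h hC hD
  exact exists_hasVKZeroFreeRegion_of_richert hA (Bexp_nonneg D) hRich

end GaussianHecke

end Literature.NumberTheory.LFunctions
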